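import Summits.Ventures.Crystal3D.Bulk.ConvexPositionGluing
import HarnessLib

/-!
# Gluing convex spherical polygons read CLOCKWISE — the bookkeeping between the face walks of
# the hull rotation system (faces on the right) and the convex-position lemmas of
# `Bulk/ConvexPositionGluing.lean` (brick for LEMMA L by edge insertion,
# `HOME/lean/lemmaL/DESIGN.md` R1.7′)

HONEST FRAMING. Part of the venture `Summits/Ventures/Crystal3D` (cell `pub-crystal3d`, phase 2;
seat typer-bulk-2), configuration-free: finite sequences of vectors of `ℝ³` and the orientation
`orient3` only; nothing about GAP(1.26). The face permutation `φ = σ ∘ α` of the hull rotation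
system traverses every face CLOCKWISE seen from outside (`HullRotSys.orient3_faceTri_neg`: the
face is on the RIGHT of the walk), so along a face walk `v 0, v 1, …` convexity reads
`∀ i < j < k, 0 < orient3 (v k) (v j) (v i)` — convex position of the REVERSED walk. This file
transports p3's convex-position lemmas to that reading:

* `cw_iff_convexPos_rev` — clockwise convexity of `v 0..v (n−1)` is convex position of
  `i ↦ v (n−1−i)`; `cw_congr`, `cw_cyclic₁`, `cw_cyclic₂`;
* `cw_rotate` — invariance under cyclic rotation of the indices; `cw_shift_of_mod` — for an
  `n`-periodic sequence, every shift `i ↦ v (i + r)` is again clockwise convex;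
* `convexPos_rotrev_of_cw` — the reversed walk started at the same vertex,
  `j ↦ v ((n − j) % n)`, is in convex position;
* **`cw_glue`** (TWO-PIECE GLUING, clockwise form) — two clockwise-convex closed walks
  `F₁` (period `k ≥ 3`) and `F₂` (period `m ≥ 3`) through a common side traversed oppositely
  (`F₁ 0 = F₂ 1`, `F₁ 1 = F₂ 0`), whose union has convex corners at the two ends of that side,
  merge into the clockwise-convex walk `F₁ 1, …, F₁ (k−1), F₂ 1, …, F₂ (m−1)` of length
  `k + m − 2` — by `convexPos_glue` applied to the reversed, rotated walk.

This is exactly the shape in which the merged face of `Bulk/RotSysFaceWalk.lean` presents itself.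
-/

noncomputable section

namespace Summit.Ventures.Crystal3D

open Literature.Geometry.DiscreteGeometry

variable {n : ℕ} {v : ℕ → EuclideanSpace ℝ (Fin 3)}

/-! ## Clockwise convexity versus convex position -/

/-- **Clockwise convexity is convex position of the reversed sequence.** -/
theorem cw_iff_convexPos_rev (v : ℕ → EuclideanSpace ℝ (Fin 3)) (n : ℕ) :
    (∀ i j k, i < j → j < k → k < n → 0 < orient3 (v k) (v j) (v i)) ↔
      ∀ i j k, i < j → j < k → k < n → 0 < orient3 (v (n - 1 - i)) (v (n - 1 - j))
        (v (n - 1 - k)) := by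
  constructor
  · intro h i j k hij hjk hk
    exact h (n - 1 - k) (n - 1 - j) (n - 1 - i) (by omega) (by omega) (by omega)
  · intro h i j k hij hjk hk
    have := h (n - 1 - k) (n - 1 - j) (n - 1 - i) (by omega) (by omega) (by omega)
    rwa [show n - 1 - (n - 1 - k) = k by omega, show n - 1 - (n - 1 - j) = j by omega,
      show n - 1 - (n - 1 - i) = i by omega] at this

/-- Clockwise convexity depends only on the values below `n`. -/
theorem cw_congr {v v' : ℕ → EuclideanSpace ℝ (Fin 3)} (h : ∀ i, i < n → v' i = v i)
    (hv : ∀ i j k, i < j → j < k → k < n → 0 < orient3 (v k) (v j) (v i)) :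
    ∀ i j k, i < j → j < k → k < n → 0 < orient3 (v' k) (v' j) (v' i) := by
  intro i j k hij hjk hk
  rw [h i (by omega), h j (by omega), h k hk]
  exact hv i j k hij hjk hk

/-- In clockwise-convex position, `0 < orient3 (v i) (v k) (v j)` for `i < j < k`. -/
theorem cw_cyclic₁ (hv : ∀ i j k, i < j → j < k → k < n → 0 < orient3 (v k) (v j) (v i))
    {i j k : ℕ} (hij : i < j) (hjk : j < k) (hk : k < n) : 0 < orient3 (v i) (v k) (v j) := by
  rw [orient3_cyclic]; exact hv i j k hij hjk hk

/-- In clockwise-convex position, `0 < orient3 (v j) (v i) (v k)` for `i < j < k`. -/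
theorem cw_cyclic₂ (hv : ∀ i j k, i < j → j < k → k < n → 0 < orient3 (v k) (v j) (v i))
    {i j k : ℕ} (hij : i < j) (hjk : j < k) (hk : k < n) : 0 < orient3 (v j) (v i) (v k) := by
  rw [← orient3_cyclic]; exact hv i j k hij hjk hk

/-- **Clockwise convexity is invariant under cyclic rotation of the indices.** -/
theorem cw_rotate (hv : ∀ i j k, i < j → j < k → k < n → 0 < orient3 (v k) (v j) (v i))
    (r : ℕ) :
    ∀ i j k, i < j → j < k → k < n → 0 < orient3 (v ((k + r) % n)) (v ((j + r) % n))
      (v ((i + r) % n)) := by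
  intro i j k hij hjk hk
  have hn : 0 < n := by omega
  set s := r % n with hs
  have hsn : s < n := Nat.mod_lt r hn
  have hmod : ∀ x, (x + r) % n = (x + s) % n := fun x => by rw [hs, Nat.add_mod_mod]
  rw [hmod i, hmod j, hmod k]
  rcases Nat.lt_or_ge (k + s) n with hk' | hk'
  · rw [Nat.mod_eq_of_lt (by omega : i + s < n), Nat.mod_eq_of_lt (by omega : j + s < n),
      Nat.mod_eq_of_lt hk']
    exact hv _ _ _ (by omega) (by omega) hk'
  rcases Nat.lt_or_ge (j + s) n with hj' | hj'
  · -- only `k` wraps: `(k+s-n) < (i+s) < (j+s)`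
    rw [Nat.mod_eq_of_lt (by omega : i + s < n), Nat.mod_eq_of_lt hj',
      Nat.mod_eq_sub_mod hk', Nat.mod_eq_of_lt (by omega : k + s - n < n)]
    exact cw_cyclic₁ hv (i := k + s - n) (j := i + s) (k := j + s) (by omega) (by omega) hj'
  rcases Nat.lt_or_ge (i + s) n with hi' | hi'
  · -- `j` and `k` wrap: `(j+s-n) < (k+s-n) < (i+s)`
    rw [Nat.mod_eq_of_lt hi', Nat.mod_eq_sub_mod hj', Nat.mod_eq_of_lt (by omega : j + s - n < n),
      Nat.mod_eq_sub_mod hk', Nat.mod_eq_of_lt (by omega : k + s - n < n)]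
    exact cw_cyclic₂ hv (i := j + s - n) (j := k + s - n) (k := i + s) (by omega) (by omega) hi'
  · rw [Nat.mod_eq_sub_mod hi', Nat.mod_eq_of_lt (by omega : i + s - n < n),
      Nat.mod_eq_sub_mod hj', Nat.mod_eq_of_lt (by omega : j + s - n < n),
      Nat.mod_eq_sub_mod hk', Nat.mod_eq_of_lt (by omega : k + s - n < n)]
    exact hv _ _ _ (by omega) (by omega) (by omega)

/-- **Shifting a periodic clockwise-convex walk**: if `v (i % n) = v i` for all `i`, every shift
`i ↦ v (i + r)` is clockwise convex. -/
theorem cw_shift_of_mod (hv : ∀ i j k, i < j → j < k → k < n → 0 < orient3 (v k) (v j) (v i))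
    (hper : ∀ i, v (i % n) = v i) (r : ℕ) :
    ∀ i j k, i < j → j < k → k < n → 0 < orient3 (v (k + r)) (v (j + r)) (v (i + r)) :=
  cw_congr (fun i _ => (hper (i + r)).symm) (cw_rotate hv r)

/-- **The reversed walk from the same start is in convex position**: if `v 0..v (n−1)` is
clockwise convex then `j ↦ v ((n − j) % n)` (`= v 0, v (n−1), …, v 1`) is in convex position. -/
theorem convexPos_rotrev_of_cw (hv : ∀ i j k, i < j → j < k → k < n → 0 < orient3 (v k) (v j) (v i)) :
    ∀ i j k, i < j → j < k → k < n → 0 < orient3 (v ((n - i) % n)) (v ((n - j) % n))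
      (v ((n - k) % n)) := by
  have hrev := (cw_iff_convexPos_rev v n).1 hv
  have hrot := convexPos_rotate hrev (n - 1)
  refine convexPos_congr (fun i hi => ?_) hrot
  -- `v (n - 1 - ((i + (n-1)) % n)) = v ((n - i) % n)`
  congr 1
  rcases Nat.eq_zero_or_pos i with rfl | hi0
  · rw [zero_add, Nat.mod_eq_of_lt (by omega : n - 1 < n), Nat.sub_zero, Nat.mod_self]; omega
  · rw [show i + (n - 1) = (i - 1) + n by omega, Nat.add_mod_right,
      Nat.mod_eq_of_lt (by omega : i - 1 < n), Nat.mod_eq_of_lt (by omega : n - i < n)]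
    omega

/-! ## Two-piece gluing, clockwise form -/

/-- **TWO-PIECE GLUING, clockwise form.** Let `F₁` be a clockwise-convex walk of length `k ≥ 3`
and `F₂` one of length `m ≥ 3`, sharing the side `a c` traversed oppositely: `F₁ 0 = a = F₂ 1`,
`F₁ 1 = c = F₂ 0`. Suppose the two corners of the union are convex (clockwise): at `a`,
`0 < orient3 (F₂ 2) a (F₁ (k−1))`, and at `c`, `0 < orient3 (F₁ 2) c (F₂ (m−1))`. Then the
merged walk `F₁ 1, F₁ 2, …, F₁ (k−1), F₂ 1, F₂ 2, …, F₂ (m−1)` (drop the shared side) of length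
`k + m − 2` is clockwise convex. -/
theorem cw_glue {k m : ℕ} {F₁ F₂ : ℕ → EuclideanSpace ℝ (Fin 3)} (hk : 3 ≤ k) (hm : 3 ≤ m)
    (h₁ : ∀ i j l, i < j → j < l → l < k → 0 < orient3 (F₁ l) (F₁ j) (F₁ i))
    (h₂ : ∀ i j l, i < j → j < l → l < m → 0 < orient3 (F₂ l) (F₂ j) (F₂ i))
    (ha : F₁ 0 = F₂ 1) (hc : F₁ 1 = F₂ 0)
    (hca : 0 < orient3 (F₂ 2) (F₁ 0) (F₁ (k - 1)))
    (hcc : 0 < orient3 (F₁ 2) (F₁ 1) (F₂ (m - 1))) :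
    ∀ i j l, i < j → j < l → l < k + m - 2 →
      0 < orient3 (if l + 1 < k then F₁ (l + 1) else F₂ (l + 2 - k))
        (if j + 1 < k then F₁ (j + 1) else F₂ (j + 2 - k))
        (if i + 1 < k then F₁ (i + 1) else F₂ (i + 2 - k)) := by
  -- the merged walk `W` and the reversed-rotated walk `w` fed to `convexPos_glue`
  set W : ℕ → EuclideanSpace ℝ (Fin 3) :=
    fun i => if i + 1 < k then F₁ (i + 1) else F₂ (i + 2 - k) with hW
  set w : ℕ → EuclideanSpace ℝ (Fin 3) :=
    fun i => if i < m then F₂ ((m - i) % m) else F₁ (k + m - 1 - i) with hw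
  have hW₁ : ∀ t, t + 1 < k → W t = F₁ (t + 1) := fun t ht => by
    simp only [hW]; rw [if_pos ht]
  have hW₂ : ∀ t, ¬ t + 1 < k → W t = F₂ (t + 2 - k) := fun t ht => by
    simp only [hW]; rw [if_neg ht]
  have hw₁ : ∀ t, t < m → w t = F₂ ((m - t) % m) := fun t ht => by
    simp only [hw]; rw [if_pos ht]
  have hw₂ : ∀ t, ¬ t < m → w t = F₁ (k + m - 1 - t) := fun t ht => by
    simp only [hw]; rw [if_neg ht]
  -- piece `P = w 0..w (m-1)`: the reversed walk of `F₂` from `c`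
  have hP : ∀ i j l, i < j → j < l → l < m → 0 < orient3 (w i) (w j) (w l) :=
    convexPos_congr (fun i hi => hw₁ i hi) (convexPos_rotrev_of_cw h₂)
  -- piece `Q`: the reversed walk of `F₁` from `a`, `Q j = F₁ ((k - j) % k)`;
  -- `w i = Q (i + 1 - m)` on `m - 1 ≤ i < k + m - 2`, and `w 0 = Q (k - 1)`
  have hQ' := convexPos_rotrev_of_cw h₁
  have hwQ : ∀ i, m - 1 ≤ i → i < k + m - 2 → w i = F₁ ((k - (i + 1 - m)) % k) := by
    intro i hmi hi
    rcases Nat.lt_or_ge i m with him | him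
    · have hi' : i = m - 1 := by omega
      rw [hi', hw₁ (m - 1) (by omega), show m - (m - 1) = 1 by omega,
        Nat.mod_eq_of_lt (by omega : 1 < m), show k - (m - 1 + 1 - m) = k by omega,
        Nat.mod_self, ha]
    · rw [hw₂ i (not_lt.2 him), Nat.mod_eq_of_lt (by omega : k - (i + 1 - m) < k)]
      congr 1; omega
  have hw0 : w 0 = F₁ ((k - (k - 1)) % k) := by
    rw [hw₁ 0 (by omega), Nat.sub_zero, Nat.mod_self, show k - (k - 1) = 1 by omega,
      Nat.mod_eq_of_lt (by omega : 1 < k), hc]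
  have hQ : ∀ i j l, m - 1 ≤ i → i < j → j < l → l < m + (k - 2) →
      0 < orient3 (w i) (w j) (w l) := by
    intro i j l hi hij hjl hl
    rw [hwQ i hi (by omega), hwQ j (by omega) (by omega), hwQ l (by omega) (by omega)]
    exact hQ' (i + 1 - m) (j + 1 - m) (l + 1 - m) (by omega) (by omega) (by omega)
  have hQ0 : ∀ i j, m - 1 ≤ i → i < j → j < m + (k - 2) → 0 < orient3 (w i) (w j) (w 0) := by
    intro i j hi hij hj
    rw [hwQ i hi (by omega), hwQ j (by omega) (by omega), hw0]
    exact hQ' (i + 1 - m) (j + 1 - m) (k - 1) (by omega) (by omega) (by omega)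
  -- the two corners of the union
  have hc1 : 1 ≤ k - 2 → 0 < orient3 (w (m - 2)) (w (m - 1)) (w m) := by
    intro _
    have e1 : w (m - 2) = F₂ 2 := by
      rw [hw₁ (m - 2) (by omega), show m - (m - 2) = 2 by omega,
        Nat.mod_eq_of_lt (by omega : 2 < m)]
    have e2 : w (m - 1) = F₁ 0 := by
      rw [hw₁ (m - 1) (by omega), show m - (m - 1) = 1 by omega,
        Nat.mod_eq_of_lt (by omega : 1 < m), ha]
    have e3 : w m = F₁ (k - 1) := by
      rw [hw₂ m (lt_irrefl m)]; congr 1; omega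
    rw [e1, e2, e3]; exact hca
  have hc3 : 1 ≤ k - 2 → 0 < orient3 (w (m + (k - 2) - 1)) (w 0) (w 1) := by
    intro _
    have e1 : w (m + (k - 2) - 1) = F₁ 2 := by
      rw [hw₂ _ (by omega)]; congr 1; omega
    have e2 : w 0 = F₁ 1 := by
      rw [hw0, show k - (k - 1) = 1 by omega, Nat.mod_eq_of_lt (by omega : 1 < k)]
    have e3 : w 1 = F₂ (m - 1) := by
      rw [hw₁ 1 (by omega), Nat.mod_eq_of_lt (by omega : m - 1 < m)]
    rw [e1, e2, e3]; exact hcc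
  have hglue := convexPos_glue (w := w) hm hP hQ hQ0 hc1 hc3
  -- back to `W`: `W (N - 1 - i) = w ((i + 1) % N)` with `N = k + m - 2`
  rw [show m + (k - 2) = k + m - 2 by omega] at hglue
  have hrot := convexPos_rotate hglue 1
  have key : ∀ i, i < k + m - 2 → W (k + m - 2 - 1 - i) = w ((i + 1) % (k + m - 2)) := by
    intro i hi
    rcases Nat.lt_or_ge (i + 1) (k + m - 2) with hlt | hge
    · rw [Nat.mod_eq_of_lt hlt]
      rcases Nat.lt_or_ge (i + 1) m with him | him
      · -- in the `F₂` part
        rw [hW₂ _ (by omega), hw₁ _ him, Nat.mod_eq_of_lt (by omega : m - (i + 1) < m)]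
        congr 1; omega
      · -- in the `F₁` part
        rw [hW₁ _ (by omega), hw₂ _ (not_lt.2 him)]
        congr 1; omega
    · -- `i = N - 1`: `W 0 = F₁ 1 = c = w 0`
      have hi' : i + 1 = k + m - 2 := by omega
      rw [hi', Nat.mod_self, show k + m - 2 - 1 - i = 0 by omega, hW₁ 0 (by omega), hw0,
        show k - (k - 1) = 1 by omega, Nat.mod_eq_of_lt (by omega : 1 < k)]
  have hrev : ∀ i j l, i < j → j < l → l < k + m - 2 →
      0 < orient3 (W (k + m - 2 - 1 - i)) (W (k + m - 2 - 1 - j)) (W (k + m - 2 - 1 - l)) :=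
    convexPos_congr key hrot
  exact (cw_iff_convexPos_rev W (k + m - 2)).2 hrev

end Summit.Ventures.Crystal3D

end
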